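/-
Copyright (c) 2026 the pub-hodgecm-mathlib formalisation cell (harness21).  Prover seat hodgecm-mathlib-F0P3b-p01 (g11), T3′ holder: organ O8d-1u «UNIT ROW +
LITERAL PACKAGE» of the depth-zero κ-transfer (road «S3-tree», DESIGN v2), over ★ O8b (A-p12 (g21)) and the ★ unit-FL literal counts.
-/
import Literature.NumberTheory.Automorphic.UnitaryDepthZeroPieceOrbitalIntegral            -- ★ p845945 O8b FILE 3 v2 (A-p12 (g21))
import Literature.NumberTheory.Rogawski1990.UnitFundamentalLemmaInertSplitValuesThetaOne   -- ★ the unit-FL type-(1) θ̄ = 1 value files (frames, counts, transports)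
import Literature.NumberTheory.Rogawski1990.UnitFundamentalLemmaInertSplitValueOne          -- ★ the θ̄ = 0 value file (★ X₁ count `…_eq_phiZero_adicCompletion`)
import Literature.NumberTheory.Rogawski1990.FlickerLiteralEigenframes                      -- ★ p845870 O8d-0 (this seat)
import HarnessLib

/-!
# The depth-zero κ-transfer, type (1): the literal package and the UNIT ROW `n₀(t) + n₁(t) + n₂(t) = φ(t)` at the four Flicker literals
# (Rogawski 1990 Prop. 4.9.1; Flicker 1998 Props. 11, 14)

Topic `NumberTheory/Rogawski1990`; namespace `Literature.NumberTheory.Rogawski1990`.  THEOREMS ONLY (no definition, no instance, no notation, no named fact,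
no `sorry`); kernel lane `--supports stmt-HodgeConjecture-24833`.  Organ O8d-1u of the T3′ «DEPTH-ZERO κ-TRANSFER» (DESIGN v2, road «S3-tree»): the inputs
`hreg`, `[CompactSpace C(t)]`, `ht` (deep) of ★ `classOrbitalIntegral_eq_mul_strata_three_of_deep` (O8b FILE 3) at an element `t ∈ G′_v = U(H′)(L⁺_v)`
carried by a level-preserving congruence `ψ` onto one of Flicker's literals `t_1(x₁,x₂,x₃)`, `t_π(x₁,x₂,x₃)` whose eigenvalues are ≡ 1 (mod 𝔪_w), and the
UNIT ROW of the socket ★ `finsum_finExplicitDelta_mul_classOrbitalIntegral_eq_of_split_of_strata` (O8d-1s): the three residually-unipotent Jordan strata of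
the fixed cosets `Fix_t(G′_v ⧸ K_v)` exhaust them (★ `sum_range_ncard_strata_eq_ncard_fixedBy`), and `#Fix_t` is Flicker's count `φ₀ ∕ φ₁` (★ the measure-free
transports `natCard_fixedBy_cmLocalIntegralLevel_eq_of_congr` and counts `natCard_fixedPoints_unitaryInt_corner_eq_phiZero∕phiOne_adicCompletion`).

**Contents.**
* §1 `valuation_coeff_prod_sub_pow_lt_one` — for any valuation `v` and `x, y, z` with `v(x−1), v(y−1), v(z−1) < 1`: every coefficient of
  `(X−x)(X−y)(X−z) − (X−1)³` has valuation `< 1` (the DEEPNESS of a split literal near `1`).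
* §2 the θ̄ = 1 literals `t_π(x₁,x₂,x₃)`: `charpoly_map_eq_of_congr_flickerTorusElt` (`χ_{t,w} = ∏ (X − x_{i,w})`), `deep_of_congr_flickerTorusElt`,
  `isRegularElt_of_congr_flickerTorusElt`, `compactSpace_centralizer_of_congr_flickerTorusElt`, the unit row **`sum_ncard_rankStrata_eq_phiOne_of_congr`**
  (`((Σ_{r<3} n_r(t)) : ℚ) = φ₁(Q₁, P)`) and the value **`classOrbitalIntegral_eq_mul_strata_of_congr_flickerTorusElt`** (★ O8b FILE 3 with its three inputs
  discharged).
* §3 the θ̄ = 0 literal `t_1(a,b,c)`: the same five (`…_flickerTorusEltOne`, unit row `sum_ncard_rankStrata_eq_phiZero_of_congr`).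

HONEST LABEL: HC_CM is proved only modulo the 2 remaining named inputs (hLiu418 24832, h413 24833) until rung 0 closes; this file is count-neutral.

## References
* [Rogawski1990] J. D. Rogawski, *Automorphic Representations of Unitary Groups in Three Variables* (1990), §4.9 Prop. 4.9.1 (b) p. 55, §14.2 p. 233.
* [Flicker1998UnitaryFL] Y. Z. Flicker, *Elementary proof of the fundamental lemma for a unitary group*, Canad. J. Math. 50 (1998), Prop. 11 p. 87, Prop. 14 p. 94.
* [Kottwitz1986] R. E. Kottwitz, *Base change for unit elements of Hecke algebras*, Compositio Math. 60 (1986), §3.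
-/

set_option autoImplicit false

noncomputable section

open MeasureTheory Measure Set Function NumberField IsDedekindDomain Matrix Polynomial
open Literature.NumberTheory.Automorphic Literature.NumberTheory.Automorphic.UnitaryGroup
open Literature.NumberTheory.Automorphic.IntegralReduction Literature.NumberTheory.GaloisRepresentations
open scoped Matrix MatrixGroups ValuativeRel

namespace Literature.NumberTheory.Rogawski1990

/-! ## §1 The deepness of a split literal near `1` -/

section Deep

/-- **A split cubic with roots ≡ 1 is ≡ (X − 1)³**: for a valuation `v` and `x, y, z` with `v(x − 1), v(y − 1), v(z − 1) < 1`, every coefficient of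
`(X − x)(X − y)(X − z) − (X − 1)³` has valuation `< 1`. [cite: Kottwitz1986, §3] [cite: Rogawski1990, §4.9 p. 54] -/
theorem valuation_coeff_prod_sub_pow_lt_one {K : Type*} [Field K] {Γ : Type*} [LinearOrderedCommGroupWithZero Γ] (v : Valuation K Γ)
    {x y z : K} (hx : v (x - 1) < 1) (hy : v (y - 1) < 1) (hz : v (z - 1) < 1) (m : ℕ) :
    v (((X - C x) * (X - C y) * (X - C z) - (X - 1) ^ 3).coeff m) < 1 := by
  set a := x - 1 with ha
  set b := y - 1 with hb
  set c := z - 1 with hc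
  have hx' : x = 1 + a := by rw [ha]; ring
  have hy' : y = 1 + b := by rw [hb]; ring
  have hz' : z = 1 + c := by rw [hc]; ring
  have key : (X - C x) * (X - C y) * (X - C z) - (X - 1 : K[X]) ^ 3 =
      C (-(a * b * c) - (a * b + a * c + b * c) - (a + b + c)) + C ((a * b + a * c + b * c) + 2 * (a + b + c)) * X + C (-(a + b + c)) * X ^ 2 := by
    rw [hx', hy', hz']
    simp only [map_add, map_one, map_neg, map_sub, map_mul, map_ofNat]
    ring
  have hmul : ∀ s t : K, v s < 1 → v t < 1 → v (s * t) < 1 := fun s t hs ht => by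
    rw [map_mul]; exact mul_lt_one_of_nonneg_of_lt_one_left zero_le hs ht.le
  have hadd : ∀ s t : K, v s < 1 → v t < 1 → v (s + t) < 1 := fun s t hs ht => lt_of_le_of_lt (v.map_add _ _) (max_lt hs ht)
  have hsub : ∀ s t : K, v s < 1 → v t < 1 → v (s - t) < 1 := fun s t hs ht => lt_of_le_of_lt (v.map_sub _ _) (max_lt hs ht)
  have hneg : ∀ s : K, v s < 1 → v (-s) < 1 := fun s hs => by rwa [Valuation.map_neg]
  have h1 : v (a + b + c) < 1 := hadd _ _ (hadd _ _ hx hy) hz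
  have h2 : v (a * b + a * c + b * c) < 1 := hadd _ _ (hadd _ _ (hmul _ _ hx hy) (hmul _ _ hx hz)) (hmul _ _ hy hz)
  have habc : v (a * b * c) < 1 := hmul _ _ (hmul _ _ hx hy) hz
  have hv2 : v 2 ≤ 1 := by rw [← one_add_one_eq_two]; exact v.map_add_le v.map_one.le v.map_one.le
  have h2' : v (2 * (a + b + c)) < 1 := by
    rw [map_mul]; exact mul_lt_one_of_nonneg_of_lt_one_right hv2 zero_le h1
  have hc0 : v (-(a * b * c) - (a * b + a * c + b * c) - (a + b + c)) < 1 := hsub _ _ (hsub _ _ (hneg _ habc) h2) h1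
  have hc1 : v ((a * b + a * c + b * c) + 2 * (a + b + c)) < 1 := hadd _ _ h2 h2'
  have hc2 : v (-(a + b + c)) < 1 := hneg _ h1
  rw [key]
  simp only [coeff_add, coeff_C, coeff_C_mul, coeff_X, coeff_X_pow]
  rcases m with _ | _ | _ | m
  · simpa using hc0
  · simpa using hc1
  · simpa using hc2
  · simp

end Deep

/-! ## §2 The θ̄ = 1 literals `t_π(x₁, x₂, x₃)`: frame, characteristic polynomial, deepness, regularity, compact centraliser, unit row, value -/

section ThetaOne

variable (L : Type) [Field L] [NumberField L] [IsCMField L] (H' : Matrix (Fin 3) (Fin 3) L)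
  {v : HeightOneSpectrum (𝓞 ↥(maximalRealSubfield L))}

/-- **THE EIGENFRAME OF `t`**: if `ψ t = Tl t Tl⁻¹` is Flicker's `t_π(x₁,x₂,x₃)` (`2e = 1`, `ππ′ = 1`), then `t · Q = Q · diag(x₁,x₂,x₃)` for the frame
`Q = Tl⁻¹ (D_π h)` of ★ `literal_pi_eq_conj_diagonal`. [cite: Flicker1998UnitaryFL, §2 Prop. 3 p. 78] -/
theorem exists_frame_of_congr_flickerTorusElt {e π π' x₁ x₂ x₃ : LocalRing L v} (h2e : 2 * e = 1) (hππ : π * π' = 1)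
    (Tl : GL (Fin 3) (LocalRing L v))
    (ψ : ↥(UnitaryGroup.«local» L (IsCMField.complexConj L) 3 H' v) ≃ₜ*
        ↥(UnitaryGroup.«local» L (IsCMField.complexConj L) 3 (Matrix.of fun i j : Fin 3 => if i.val + j.val + 1 = 3 then (1 : L) else 0) v))
    (t : (cmDatum L 3 H').Local v) (hψ : ∀ g, (ψ g).val = Tl * g.val * Tl⁻¹)
    (hlit : (ψ t).val.val = !![e * (x₁ + x₃), 0, -(e * (x₁ - x₃) * π); 0, x₂, 0; -(e * (x₁ - x₃) * π'), 0, e * (x₁ + x₃)]) :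
    ∃ Q : GL (Fin 3) (LocalRing L v), (t.val.val : Matrix (Fin 3) (Fin 3) (LocalRing L v)) * Q.val = Q.val * diagonal ![x₁, x₂, x₃] := by
  set P₁ : GL (Fin 3) (LocalRing L v) := ⟨_, _, Flicker1998.flickerFramePi_mul_inv h2e hππ, Flicker1998.flickerFramePiInv_mul h2e hππ⟩ with hP₁def
  have htval : (t.val.val : Matrix (Fin 3) (Fin 3) (LocalRing L v)) = Tl⁻¹.val * (ψ t).val.val * Tl.val := by
    rw [hψ t, Units.val_mul, Units.val_mul, ← Matrix.mul_assoc, ← Matrix.mul_assoc, ← Units.val_mul, inv_mul_cancel, Units.val_one, Matrix.one_mul,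
      Matrix.mul_assoc, ← Units.val_mul, inv_mul_cancel, Units.val_one, Matrix.mul_one]
  refine ⟨Tl⁻¹ * P₁, ?_⟩
  have hlit' : (ψ t).val.val = P₁.val * diagonal ![x₁, x₂, x₃] * (P₁⁻¹).val := by
    rw [hlit, Flicker1998.literal_pi_eq_conj_diagonal hππ, ← Flicker1998.diagonal_fin_three x₁ x₂ x₃]; rfl
  rw [htval, Units.val_mul, hlit', Matrix.mul_assoc, Matrix.mul_assoc, Matrix.mul_assoc, ← Matrix.mul_assoc Tl.val, ← Units.val_mul, mul_inv_cancel,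
    Units.val_one, Matrix.one_mul, ← Units.val_mul P₁⁻¹, inv_mul_cancel, Units.val_one, Matrix.mul_one, ← Matrix.mul_assoc]

/-- **`χ_{t,w} = (X − x_{1,w})(X − x_{2,w})(X − x_{3,w})`** for `t` congruent to `t_π(x₁,x₂,x₃)` (conjugation does not change `charpoly`; `charpoly` of a diagonal).
[cite: Flicker1998UnitaryFL, §2 Prop. 3 p. 78] -/
theorem charpoly_map_eq_of_congr_flickerTorusElt (w : PlacesOver L v) {e π π' x₁ x₂ x₃ : LocalRing L v} (h2e : 2 * e = 1) (hππ : π * π' = 1)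
    (Tl : GL (Fin 3) (LocalRing L v))
    (ψ : ↥(UnitaryGroup.«local» L (IsCMField.complexConj L) 3 H' v) ≃ₜ*
        ↥(UnitaryGroup.«local» L (IsCMField.complexConj L) 3 (Matrix.of fun i j : Fin 3 => if i.val + j.val + 1 = 3 then (1 : L) else 0) v))
    (t : (cmDatum L 3 H').Local v) (hψ : ∀ g, (ψ g).val = Tl * g.val * Tl⁻¹)
    (hlit : (ψ t).val.val = !![e * (x₁ + x₃), 0, -(e * (x₁ - x₃) * π); 0, x₂, 0; -(e * (x₁ - x₃) * π'), 0, e * (x₁ + x₃)]) :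
    (((t.val : GL (Fin 3) (LocalRing L v)).val.map (Pi.evalRingHom (fun w' : PlacesOver L v => w'.1.adicCompletion L) w))).charpoly =
      (X - C (x₁ w)) * (X - C (x₂ w)) * (X - C (x₃ w)) := by
  obtain ⟨Q, hQ⟩ := exists_frame_of_congr_flickerTorusElt L H' h2e hππ Tl ψ t hψ hlit
  have ht : (t.val.val : Matrix (Fin 3) (Fin 3) (LocalRing L v)) = Q.val * diagonal ![x₁, x₂, x₃] * Q.val⁻¹ := by
    rw [← hQ, Matrix.mul_assoc, Matrix.mul_nonsing_inv _ (Matrix.isUnits_det_units Q), Matrix.mul_one]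
  rw [Matrix.charpoly_map, ht, Matrix.charpoly_units_conj, Matrix.charpoly_diagonal, Polynomial.map_prod, Fin.prod_univ_three]
  simp only [Polynomial.map_sub, Polynomial.map_X, Polynomial.map_C, Matrix.cons_val_zero, Matrix.cons_val_one, Matrix.cons_val]
  rfl

/-- **DEEPNESS**: if the eigenvalues of the literal are ≡ 1 (`|x_{i,w} − 1|_w < 1`), then `χ_{t,w} ≡ (X − 1)³ (mod 𝔪_w)` coefficientwise — the `ht` input of ★
`classOrbitalIntegral_eq_mul_strata_three_of_deep`. [cite: Kottwitz1986, §3] [cite: Rogawski1990, §4.9 p. 54] -/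
theorem deep_of_congr_flickerTorusElt (w : PlacesOver L v) {e π π' x₁ x₂ x₃ : LocalRing L v} (h2e : 2 * e = 1) (hππ : π * π' = 1)
    (Tl : GL (Fin 3) (LocalRing L v))
    (ψ : ↥(UnitaryGroup.«local» L (IsCMField.complexConj L) 3 H' v) ≃ₜ*
        ↥(UnitaryGroup.«local» L (IsCMField.complexConj L) 3 (Matrix.of fun i j : Fin 3 => if i.val + j.val + 1 = 3 then (1 : L) else 0) v))
    (t : (cmDatum L 3 H').Local v) (hψ : ∀ g, (ψ g).val = Tl * g.val * Tl⁻¹)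
    (hlit : (ψ t).val.val = !![e * (x₁ + x₃), 0, -(e * (x₁ - x₃) * π); 0, x₂, 0; -(e * (x₁ - x₃) * π'), 0, e * (x₁ + x₃)])
    (hd₁ : Valued.v (x₁ w - 1) < 1) (hd₂ : Valued.v (x₂ w - 1) < 1) (hd₃ : Valued.v (x₃ w - 1) < 1) :
    ∀ m : ℕ, ValuativeRel.valuation (w.1.adicCompletion L)
      (((((t.val : GL (Fin 3) (LocalRing L v)).val.map (Pi.evalRingHom (fun w' : PlacesOver L v => w'.1.adicCompletion L) w))).charpoly -
        (Polynomial.X - 1) ^ 3).coeff m) < 1 := by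
  have hiso := ValuativeRel.isEquiv (ValuativeRel.valuation (w.1.adicCompletion L))
    (Valued.v : Valuation (w.1.adicCompletion L) (WithZero (Multiplicative ℤ)))
  intro m
  rw [charpoly_map_eq_of_congr_flickerTorusElt L H' w h2e hππ Tl ψ t hψ hlit]
  exact valuation_coeff_prod_sub_pow_lt_one _ (hiso.lt_one_iff_lt_one.2 hd₁) (hiso.lt_one_iff_lt_one.2 hd₂) (hiso.lt_one_iff_lt_one.2 hd₃) m

/-- **REGULARITY**: `t` congruent to `t_π(x₁,x₂,x₃)` with `x_i` pairwise distinct is a regular element (★ `isRegularElt_of_eigenframe`).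
[cite: Flicker1998UnitaryFL, §2 Prop. 3 p. 78] [cite: Rogawski1990, §4.9 p. 54] -/
theorem isRegularElt_of_congr_flickerTorusElt (w : PlacesOver L v) (hw : IsCMField.complexConj L • w.1 = w.1)
    {e π π' x₁ x₂ x₃ : LocalRing L v} (h2e : 2 * e = 1) (hππ : π * π' = 1) (h₁₂ : x₁ ≠ x₂) (h₂₃ : x₂ ≠ x₃) (h₁₃ : x₁ ≠ x₃)
    (Tl : GL (Fin 3) (LocalRing L v))
    (ψ : ↥(UnitaryGroup.«local» L (IsCMField.complexConj L) 3 H' v) ≃ₜ*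
        ↥(UnitaryGroup.«local» L (IsCMField.complexConj L) 3 (Matrix.of fun i j : Fin 3 => if i.val + j.val + 1 = 3 then (1 : L) else 0) v))
    (t : (cmDatum L 3 H').Local v) (hψ : ∀ g, (ψ g).val = Tl * g.val * Tl⁻¹)
    (hlit : (ψ t).val.val = !![e * (x₁ + x₃), 0, -(e * (x₁ - x₃) * π); 0, x₂, 0; -(e * (x₁ - x₃) * π'), 0, e * (x₁ + x₃)]) :
    IsRegularElt (t.val : GL (Fin 3) (LocalRing L v)) := by
  obtain ⟨Q, hQ⟩ := exists_frame_of_congr_flickerTorusElt L H' h2e hππ Tl ψ t hψ hlit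
  have hu : Function.Injective ![x₁, x₂, x₃] := by
    intro i j hij
    fin_cases i <;> fin_cases j
    all_goals first | rfl | (exfalso; revert hij; simp [h₁₂, h₂₃, h₁₃, h₁₂.symm, h₂₃.symm, h₁₃.symm])
  exact isRegularElt_of_eigenframe L H' w hw t hQ hu

/-- **COMPACT CENTRALISER**: `t` congruent to `t_π(x₁,x₂,x₃)` with `x_i` pairwise distinct of norm one has compact centraliser in `G′_v`
(★ `compactSpace_centralizer_of_eigenframe_of_smul_eq`). [cite: Flicker1998UnitaryFL, §2 Prop. 3 p. 78] [cite: Rogawski1990, §4.9 p. 54] -/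
theorem compactSpace_centralizer_of_congr_flickerTorusElt (hH' : (H'.map (IsCMField.complexConj L))ᵀ = H') (hH'u : IsUnit H')
    (w : PlacesOver L v) (hw : IsCMField.complexConj L • w.1 = w.1)
    {e π π' x₁ x₂ x₃ : LocalRing L v} (h2e : 2 * e = 1) (hππ : π * π' = 1)
    (hx₁ : conjLocal L (IsCMField.complexConj L) v x₁ * x₁ = 1) (hx₂ : conjLocal L (IsCMField.complexConj L) v x₂ * x₂ = 1)
    (hx₃ : conjLocal L (IsCMField.complexConj L) v x₃ * x₃ = 1) (h₁₂ : x₁ ≠ x₂) (h₂₃ : x₂ ≠ x₃) (h₁₃ : x₁ ≠ x₃)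
    (Tl : GL (Fin 3) (LocalRing L v))
    (ψ : ↥(UnitaryGroup.«local» L (IsCMField.complexConj L) 3 H' v) ≃ₜ*
        ↥(UnitaryGroup.«local» L (IsCMField.complexConj L) 3 (Matrix.of fun i j : Fin 3 => if i.val + j.val + 1 = 3 then (1 : L) else 0) v))
    (t : (cmDatum L 3 H').Local v) (hψ : ∀ g, (ψ g).val = Tl * g.val * Tl⁻¹)
    (hlit : (ψ t).val.val = !![e * (x₁ + x₃), 0, -(e * (x₁ - x₃) * π); 0, x₂, 0; -(e * (x₁ - x₃) * π'), 0, e * (x₁ + x₃)]) :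
    CompactSpace (Subgroup.centralizer ({t} : Set ((cmDatum L 3 H').Local v))) := by
  obtain ⟨Q, hQ⟩ := exists_frame_of_congr_flickerTorusElt L H' h2e hππ Tl ψ t hψ hlit
  have hu : Function.Injective ![x₁, x₂, x₃] := by
    intro i j hij
    fin_cases i <;> fin_cases j
    all_goals first | rfl | (exfalso; revert hij; simp [h₁₂, h₂₃, h₁₃, h₁₂.symm, h₂₃.symm, h₁₃.symm])
  have hu1 : ∀ i, conjLocal L (IsCMField.complexConj L) v (![x₁, x₂, x₃] i) * ![x₁, x₂, x₃] i = 1 := by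
    intro i; fin_cases i
    · exact hx₁
    · exact hx₂
    · exact hx₃
  have hH'c : (H'.map (cmConjRingHom L))ᵀ = H' := by
    have e1 : H'.map (cmConjRingHom L) = H'.map (IsCMField.complexConj L) := by
      ext i j; simp [Matrix.map_apply, cmConjRingHom_apply]
    rw [e1]; exact hH'
  have hdet : H'.det ≠ 0 := (Matrix.isUnit_iff_isUnit_det _ |>.1 hH'u).ne_zero
  exact compactSpace_centralizer_of_eigenframe_of_smul_eq L w hw H' hH'c hdet t hQ hu hu1


set_option synthInstance.maxHeartbeats 200000 in  -- the coset action `U_w ↷ U_w ⧸ unitaryInt` (as in ★ `FixedCosetsTransport`)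
open scoped Classical in
/-- **THE UNIT ROW AT A θ̄ = 1 LITERAL (measure-free)**: for `t ∈ G′_v` congruent to `t_π(x₁,x₂,x₃)` with `x_i` pairwise distinct of norm one and ≡ 1 (mod 𝔪_w),
`P = ord_w(x₁ − x₃)`, `Q₁ = ord_w(x₁ − x₂)`: the three residually-unipotent Jordan strata of `Fix_t(G′_v ⧸ K_v)` exhaust it and
`n₀(t) + n₁(t) + n₂(t) = #Fix_t = φ₁(Q₁, P)` (★ `sum_range_ncard_strata_eq_ncard_fixedBy` ∘ ★ `natCard_fixedBy_cmLocalIntegralLevel_eq_of_congr` ∘ ★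
`natCard_fixedPoints_unitaryInt_corner_eq_phiOne_adicCompletion`). [cite: Flicker1998UnitaryFL, Prop. 11 p. 87; §6 p. 95] [cite: Rogawski1990, §4.9 Prop. 4.9.1 (b) p. 55]
[cite: Kottwitz1986, §3] -/
theorem sum_ncard_rankStrata_eq_phiOne_of_congr
    (hH' : (H'.map (IsCMField.complexConj L))ᵀ = H') (hH'u : IsUnit H') (w : PlacesOver L v)
    (hw : IsCMField.complexConj L • w.1 = w.1) (hv : Algebra.IsUnramifiedIn (𝓞 L) v.asIdeal)
    (h2 : IsUnit (2 : 𝒪[w.1.adicCompletion L]))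
    {e π π' y x₁ x₂ x₃ : LocalRing L v} (h2e : 2 * e = 1) (hσπ : conjLocal L (IsCMField.complexConj L) v π = π) (hππ : π * π' = 1)
    (hπN : ∀ z : LocalRing L v, conjLocal L (IsCMField.complexConj L) v z * z ≠ π)
    (hy : conjLocal L (IsCMField.complexConj L) v y * y = -2)
    (hx₁ : conjLocal L (IsCMField.complexConj L) v x₁ * x₁ = 1) (hx₂ : conjLocal L (IsCMField.complexConj L) v x₂ * x₂ = 1)
    (hx₃ : conjLocal L (IsCMField.complexConj L) v x₃ * x₃ = 1) (h₁₂ : x₁ ≠ x₂) (h₂₃ : x₂ ≠ x₃) (h₁₃ : x₁ ≠ x₃)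
    (Tl : GL (Fin 3) (LocalRing L v))
    (ψ : ↥(UnitaryGroup.«local» L (IsCMField.complexConj L) 3 H' v) ≃ₜ*
        ↥(UnitaryGroup.«local» L (IsCMField.complexConj L) 3 (Matrix.of fun i j : Fin 3 => if i.val + j.val + 1 = 3 then (1 : L) else 0) v))
    (t : (cmDatum L 3 H').Local v)
    (hψ : ∀ g, (ψ g).val = Tl * g.val * Tl⁻¹)
    (hlev : ∀ g, g ∈ cmLocalIntegralLevel L 3 H' v ↔
        ψ g ∈ cmLocalIntegralLevel L 3 (Matrix.of fun i j : Fin 3 => if i.val + j.val + 1 = 3 then (1 : L) else 0) v)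
    (hlit : (ψ t).val.val =
          !![e * (x₁ + x₃), 0, -(e * (x₁ - x₃) * π); 0, x₂, 0; -(e * (x₁ - x₃) * π'), 0, e * (x₁ + x₃)])
    {P Q₁ Q₂ : ℕ} (hP : Valued.v (x₁ w - x₃ w) = WithZero.exp (-(P : ℤ))) (hQ₁ : Valued.v (x₁ w - x₂ w) = WithZero.exp (-(Q₁ : ℤ)))
    (hQ₂ : Valued.v (x₃ w - x₂ w) = WithZero.exp (-(Q₂ : ℤ)))
    (hd₁ : Valued.v (x₁ w - 1) < 1) (hd₂ : Valued.v (x₂ w - 1) < 1) (hd₃ : Valued.v (x₃ w - 1) < 1) :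
    ((∑ r ∈ Finset.range 3, {q : (cmDatum L 3 H').Local v ⧸ cmLocalIntegralLevel L 3 H' v |
        q ∈ MulAction.fixedBy ((cmDatum L 3 H').Local v ⧸ cmLocalIntegralLevel L 3 H' v) t ∧
          (redMat ((((q.out⁻¹ * t * q.out : (cmDatum L 3 H').Local v)).val : GL (Fin 3) (LocalRing L v)).val.map
            (Pi.evalRingHom (fun w' : PlacesOver L v => w'.1.adicCompletion L) w)) - 1).rank = r}.ncard : ℕ) : ℚ) =
      Flicker1998.phiOne (Ideal.absNorm v.asIdeal) Q₁ P := by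
  have hc1 : IsCMField.complexConj L ≠ 1 := IsCMField.complexConj_ne_one L
  -- `𝒪_w` is `𝔪`-adically complete (★ p842102)
  haveI : IsAdicComplete (IsLocalRing.maximalIdeal (Valued.integer (w.1.adicCompletion L))) (Valued.integer (w.1.adicCompletion L)) :=
    isAdicComplete_maximalIdeal_valuedInteger_adicCompletion L w.1
  haveI : Algebra.IsQuadraticExtension ↥(maximalRealSubfield L) L := IsCMField.isQuadraticExtension L
  -- (1) regularity, compact centraliser, deepness
  have hH'c : (H'.map (cmConjRingHom L))ᵀ = H' := by
    have e1 : H'.map (cmConjRingHom L) = H'.map (IsCMField.complexConj L) := by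
      ext i j; simp [Matrix.map_apply, cmConjRingHom_apply]
    rw [e1]; exact hH'
  have hdet : H'.det ≠ 0 := (Matrix.isUnit_iff_isUnit_det _ |>.1 hH'u).ne_zero
  have hreg : IsRegularElt (t.val : GL (Fin 3) (LocalRing L v)) := isRegularElt_of_congr_flickerTorusElt L H' w hw h2e hππ h₁₂ h₂₃ h₁₃ Tl ψ t hψ hlit
  haveI : CompactSpace (Subgroup.centralizer ({t} : Set ((cmDatum L 3 H').Local v))) :=
    compactSpace_centralizer_of_congr_flickerTorusElt L H' hH' hH'u w hw h2e hππ hx₁ hx₂ hx₃ h₁₂ h₂₃ h₁₃ Tl ψ t hψ hlit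
  have ht := deep_of_congr_flickerTorusElt L H' w h2e hππ Tl ψ t hψ hlit hd₁ hd₂ hd₃
  -- (2) the strata exhaust the fixed cosets (★ O8b)
  have hpart : ∑ r ∈ Finset.range 3, {q : (cmDatum L 3 H').Local v ⧸ cmLocalIntegralLevel L 3 H' v |
        q ∈ MulAction.fixedBy ((cmDatum L 3 H').Local v ⧸ cmLocalIntegralLevel L 3 H' v) t ∧
          (redMat ((((q.out⁻¹ * t * q.out : (cmDatum L 3 H').Local v)).val : GL (Fin 3) (LocalRing L v)).val.map
            (Pi.evalRingHom (fun w' : PlacesOver L v => w'.1.adicCompletion L) w)) - 1).rank = r}.ncard =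
      (MulAction.fixedBy ((cmDatum L 3 H').Local v ⧸ cmLocalIntegralLevel L 3 H' v) t).ncard :=
    sum_range_ncard_strata_eq_ncard_fixedBy t (cmLocalIntegralLevel L 3 H' v)
      (isCompact_isOpen_cmLocalIntegralLevel L 3 H' v).2 (isCompact_isOpen_cmLocalIntegralLevel L 3 H' v).1
      (isClosed_conjClass_local_of_isRegularElt L 3 H' v hH'c hdet t hreg)
      {k | (redMat (((k.val : GL (Fin 3) (LocalRing L v)).val.map (Pi.evalRingHom (fun w' : PlacesOver L v => w'.1.adicCompletion L) w))) - 1) ^ 3 = 0}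
      (fun k => (redMat (((k.val : GL (Fin 3) (LocalRing L v)).val.map (Pi.evalRingHom (fun w' : PlacesOver L v => w'.1.adicCompletion L) w))) - 1).rank) 3
      (fun k _ hkU => rank_lt_of_isNilpotent ⟨3, hkU⟩ (by norm_num)) (fun x hx => redMat_sub_one_pow_eq_zero_of_deep L 3 H' v w hw t ht x hx)
  rw [hpart, ← Nat.card_coe_set_eq, natCard_fixedBy_cmLocalIntegralLevel_eq_of_congr L H' w hw ψ hlev t]
  -- (3) the data at `w`
  have h2L : (2 : 𝓞 L) ∉ w.1.asIdeal := by
    have h2w : Valued.v (2 : w.1.adicCompletion L) = 1 := (isUnit_two_integer_iff_valued_eq_one L w.1).1 h2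
    have e1 : (algebraMap L (w.1.adicCompletion L)) (algebraMap (𝓞 L) L 2) = 2 := by rw [map_ofNat, map_ofNat]
    rw [← e1] at h2w
    change Valued.v ((algebraMap (𝓞 L) L 2 : L) : w.1.adicCompletion L) = 1 at h2w
    rw [HeightOneSpectrum.valuedAdicCompletion_eq_valuation', HeightOneSpectrum.valuation_of_algebraMap] at h2w
    exact HeightOneSpectrum.intValuation_eq_one_iff.1 h2w
  have h2F : (2 : 𝓞 ↥(maximalRealSubfield L)) ∉ v.asIdeal := by
    intro hmem
    apply h2L
    have h := congrArg HeightOneSpectrum.asIdeal w.2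
    rw [← h] at hmem
    simp only [HeightOneSpectrum.under_asIdeal, Ideal.under_def, Ideal.mem_comap, map_ofNat] at hmem
    exact hmem
  have hσw : ∀ z : LocalRing L v, conjLocal L (IsCMField.complexConj L) v z w = galAdicCompletionMap (L := L) (IsCMField.complexConj L) hw (z w) :=
    fun z => conjLocal_apply_eq_of_smul_eq (IsCMField.complexConj L) hc1 v w hw z
  have hyw : y w * galAdicCompletionMap (L := L) (IsCMField.complexConj L) hw (y w) = -2 := by
    rw [← hσw, mul_comm]; exact (congrFun hy w : _)
  have hx₁w : galAdicCompletionMap (L := L) (IsCMField.complexConj L) hw (x₁ w) * x₁ w = 1 := by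
    rw [← hσw]; exact (congrFun hx₁ w : _)
  have hx₂w : galAdicCompletionMap (L := L) (IsCMField.complexConj L) hw (x₂ w) * x₂ w = 1 := by
    rw [← hσw]; exact (congrFun hx₂ w : _)
  have hx₃w : galAdicCompletionMap (L := L) (IsCMField.complexConj L) hw (x₃ w) * x₃ w = 1 := by
    rw [← hσw]; exact (congrFun hx₃ w : _)
  have h2ew : 2 * e w = 1 := by
    have := congrFun h2e w; simpa using this
  have hσπw : galAdicCompletionMap (L := L) (IsCMField.complexConj L) hw (π w) = π w := by
    rw [← hσw]; exact (congrFun hσπ w : _)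
  have hππw : π w * π' w = 1 := by
    have := congrFun hππ w; simpa using this
  have hπNw : ∀ z : w.1.adicCompletion L, galAdicCompletionMap (L := L) (IsCMField.complexConj L) hw z * z ≠ π w := by
    intro z hz
    haveI : Subsingleton (PlacesOver L v) := PlacesOver.subsingleton_of_smul_eq (IsCMField.complexConj L) hc1 w hw
    letI : Unique (PlacesOver L v) := uniqueOfSubsingleton w
    let πe : LocalRing L v ≃+* w.1.adicCompletion L := RingEquiv.piUnique fun w' : PlacesOver L v => w'.1.adicCompletion L
    have hz' : πe.symm z w = z := πe.apply_symm_apply z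
    refine hπN (πe.symm z) (πe.injective ?_)
    show (conjLocal L (IsCMField.complexConj L) v (πe.symm z) * πe.symm z) w = π w
    rw [Pi.mul_apply, hσw, hz', hz]
  -- the literal read at `w`
  have hte : (((localNonsplitEquiv (IsCMField.complexConj L) (Matrix.of fun i j : Fin 3 => if i.val + j.val + 1 = 3 then (1 : L) else 0) hc1 w hw (ψ t) :
        unitaryGroupOfForm (galAdicCompletionMap (L := L) (IsCMField.complexConj L) hw)
          (placeForm (Matrix.of fun i j : Fin 3 => if i.val + j.val + 1 = 3 then (1 : L) else 0) w.1)) :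
        GL (Fin 3) (w.1.adicCompletion L)) : Matrix (Fin 3) (Fin 3) (w.1.adicCompletion L)) =
      !![e w * (x₁ w + x₃ w), 0, -(e w * (x₁ w - x₃ w) * π w); 0, x₂ w, 0; -(e w * (x₁ w - x₃ w) * π' w), 0, e w * (x₁ w + x₃ w)] := by
    rw [coe_coe_localNonsplitEquiv_apply, hlit]
    ext i j
    fin_cases i <;> fin_cases j <;> rfl
  -- finiteness of the fixed cosets (elliptic regular `t`)
  have hfinG : (MulAction.fixedBy ((cmDatum L 3 H').Local v ⧸ cmLocalIntegralLevel L 3 H' v) t).Finite :=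
    finite_fixedBy_quotient_of_isClosed t (cmLocalIntegralLevel L 3 H' v) (isClosed_conjClass_local_of_isRegularElt L 3 H' v hH'c hdet t hreg)
      (isCompact_isOpen_cmLocalIntegralLevel L 3 H' v).2 (isCompact_isOpen_cmLocalIntegralLevel L 3 H' v).1
  have hfin := (finite_fixedBy_cmLocalIntegralLevel_iff_of_congr L H' w hw ψ hlev t).1 hfinG
  -- (4) the θ̄ = 1 count at `L_w`
  exact natCard_fixedPoints_unitaryInt_corner_eq_phiOne_adicCompletion L w hw hv h2F hyw h2ew hx₁w hx₂w hx₃w hσπw hππw hπNw hte hP hQ₁ hQ₂ hfin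

/-- **THE VALUE OF A DEPTH-ZERO PIECE AT A θ̄ = 1 LITERAL**: ★ O8b `classOrbitalIntegral_eq_mul_strata_three_of_deep` with its three inputs (`hreg`, compact
centraliser, `ht`) discharged for `t` congruent to `t_π(x₁,x₂,x₃)` near `1`: `Φ(⟦t⟧, g) = ν_G(K_v) · (c₀ n₀(t) + c₁ n₁(t) + c₂ n₂(t))` — the `hΦ₂, hΦ₃, hΦ₄` of the
socket ★ `finsum_finExplicitDelta_mul_classOrbitalIntegral_eq_of_split_of_strata`. [cite: Rogawski1990, §4.9 p. 54, Prop. 4.9.1 (b) p. 55] [cite: Kottwitz1986, §3]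
[cite: Flicker1998UnitaryFL, §2 Prop. 3 p. 78] -/
theorem classOrbitalIntegral_eq_mul_strata_of_congr_flickerTorusElt
    (hH' : (H'.map (IsCMField.complexConj L))ᵀ = H') (hH'u : IsUnit H') (w : PlacesOver L v)
    (hw : IsCMField.complexConj L • w.1 = w.1)
    [MeasurableSpace ((cmDatum L 3 H').Local v)] [BorelSpace ((cmDatum L 3 H').Local v)]
    [∀ γ : ((cmDatum L 3 H').Local v), MeasurableSpace (((cmDatum L 3 H').Local v) ⧸ Subgroup.centralizer ({γ} : Set ((cmDatum L 3 H').Local v)))]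
    [∀ γ : ((cmDatum L 3 H').Local v), BorelSpace (((cmDatum L 3 H').Local v) ⧸ Subgroup.centralizer ({γ} : Set ((cmDatum L 3 H').Local v)))]
    (νG : Measure ((cmDatum L 3 H').Local v)) [νG.IsHaarMeasure] [νG.IsMulRightInvariant]
    {mG : OrbitalMeasureFamily ((cmDatum L 3 H').Local v)}
    (hmG : mG.IsCanonical (fun γ => IsRegularElt (γ.val : GL (Fin 3) (UnitaryGroup.LocalRing L v))) νG)
    -- the depth-zero piece
    (g : ((cmDatum L 3 H').Local v) → ℂ) (hg : IsLocSmooth g) (hgK : tsupport g ⊆ (cmLocalIntegralLevel L 3 H' v : Set ((cmDatum L 3 H').Local v)))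
    (hginv : ∀ u ∈ cmLocalIntegralLevel L 3 H' v, ∀ x, g (u * x * u⁻¹) = g x)
    (c : ℕ → ℂ)
    (hc : ∀ k ∈ cmLocalIntegralLevel L 3 H' v,
      (redMat (((k.val : GL (Fin 3) (UnitaryGroup.LocalRing L v)).val.map (Pi.evalRingHom (fun w' : PlacesOver L v => w'.1.adicCompletion L) w))) - 1) ^ 3 = 0 →
      g k = c (redMat (((k.val : GL (Fin 3) (UnitaryGroup.LocalRing L v)).val.map (Pi.evalRingHom (fun w' : PlacesOver L v => w'.1.adicCompletion L) w))) - 1).rank)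
    -- the literal
    {e π π' x₁ x₂ x₃ : LocalRing L v} (h2e : 2 * e = 1) (hππ : π * π' = 1)
    (hx₁ : conjLocal L (IsCMField.complexConj L) v x₁ * x₁ = 1) (hx₂ : conjLocal L (IsCMField.complexConj L) v x₂ * x₂ = 1)
    (hx₃ : conjLocal L (IsCMField.complexConj L) v x₃ * x₃ = 1) (h₁₂ : x₁ ≠ x₂) (h₂₃ : x₂ ≠ x₃) (h₁₃ : x₁ ≠ x₃)
    (Tl : GL (Fin 3) (LocalRing L v))
    (ψ : ↥(UnitaryGroup.«local» L (IsCMField.complexConj L) 3 H' v) ≃ₜ*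
        ↥(UnitaryGroup.«local» L (IsCMField.complexConj L) 3 (Matrix.of fun i j : Fin 3 => if i.val + j.val + 1 = 3 then (1 : L) else 0) v))
    (t : (cmDatum L 3 H').Local v)
    (hψ : ∀ g, (ψ g).val = Tl * g.val * Tl⁻¹)
    (hlit : (ψ t).val.val =
          !![e * (x₁ + x₃), 0, -(e * (x₁ - x₃) * π); 0, x₂, 0; -(e * (x₁ - x₃) * π'), 0, e * (x₁ + x₃)])
    (hd₁ : Valued.v (x₁ w - 1) < 1) (hd₂ : Valued.v (x₂ w - 1) < 1) (hd₃ : Valued.v (x₃ w - 1) < 1) :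
    classOrbitalIntegral mG g (ConjClasses.mk t) =
      (νG.real (cmLocalIntegralLevel L 3 H' v : Set ((cmDatum L 3 H').Local v)) : ℂ) *
        (c 0 * ({q : (cmDatum L 3 H').Local v ⧸ cmLocalIntegralLevel L 3 H' v |
            q ∈ MulAction.fixedBy ((cmDatum L 3 H').Local v ⧸ cmLocalIntegralLevel L 3 H' v) t ∧
              (redMat ((((q.out⁻¹ * t * q.out : (cmDatum L 3 H').Local v)).val : GL (Fin 3) (LocalRing L v)).val.map
                (Pi.evalRingHom (fun w' : PlacesOver L v => w'.1.adicCompletion L) w)) - 1).rank = 0}.ncard : ℂ) +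
          c 1 * ({q : (cmDatum L 3 H').Local v ⧸ cmLocalIntegralLevel L 3 H' v |
            q ∈ MulAction.fixedBy ((cmDatum L 3 H').Local v ⧸ cmLocalIntegralLevel L 3 H' v) t ∧
              (redMat ((((q.out⁻¹ * t * q.out : (cmDatum L 3 H').Local v)).val : GL (Fin 3) (LocalRing L v)).val.map
                (Pi.evalRingHom (fun w' : PlacesOver L v => w'.1.adicCompletion L) w)) - 1).rank = 1}.ncard : ℂ) +
          c 2 * ({q : (cmDatum L 3 H').Local v ⧸ cmLocalIntegralLevel L 3 H' v |
            q ∈ MulAction.fixedBy ((cmDatum L 3 H').Local v ⧸ cmLocalIntegralLevel L 3 H' v) t ∧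
              (redMat ((((q.out⁻¹ * t * q.out : (cmDatum L 3 H').Local v)).val : GL (Fin 3) (LocalRing L v)).val.map
                (Pi.evalRingHom (fun w' : PlacesOver L v => w'.1.adicCompletion L) w)) - 1).rank = 2}.ncard : ℂ)) := by
  have hH'c : (H'.map (cmConjRingHom L))ᵀ = H' := by
    have e1 : H'.map (cmConjRingHom L) = H'.map (IsCMField.complexConj L) := by
      ext i j; simp [Matrix.map_apply, cmConjRingHom_apply]
    rw [e1]; exact hH'
  have hdet : H'.det ≠ 0 := (Matrix.isUnit_iff_isUnit_det _ |>.1 hH'u).ne_zero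
  have hreg : IsRegularElt (t.val : GL (Fin 3) (LocalRing L v)) := isRegularElt_of_congr_flickerTorusElt L H' w hw h2e hππ h₁₂ h₂₃ h₁₃ Tl ψ t hψ hlit
  haveI : CompactSpace (Subgroup.centralizer ({t} : Set ((cmDatum L 3 H').Local v))) :=
    compactSpace_centralizer_of_congr_flickerTorusElt L H' hH' hH'u w hw h2e hππ hx₁ hx₂ hx₃ h₁₂ h₂₃ h₁₃ Tl ψ t hψ hlit
  have ht := deep_of_congr_flickerTorusElt L H' w h2e hππ Tl ψ t hψ hlit hd₁ hd₂ hd₃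
  exact classOrbitalIntegral_eq_mul_strata_three_of_deep L v w hw νG hH'c hdet hmG t hreg ht g hg hgK hginv c hc

end ThetaOne

/-! ## §3 The θ̄ = 0 literal `t_1(x₁, x₂, x₃)`: the same package and the unit row `n₀ + n₁ + n₂ = φ₀(Q₁, Q₂, P)` -/

section ThetaZero

variable (L : Type) [Field L] [NumberField L] [IsCMField L] (H' : Matrix (Fin 3) (Fin 3) L)
  {v : HeightOneSpectrum (𝓞 ↥(maximalRealSubfield L))}

/-- **THE EIGENFRAME OF `t`**: if `ψ t = Tl t Tl⁻¹` is Flicker's `t_1(x₁,x₂,x₃)` (`2e = 1`, `ππ′ = 1`), then `t · Q = Q · diag(x₁,x₂,x₃)` for the frame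
`Q = Tl⁻¹ h` of ★ `literal_one_eq_conj_diagonal`. [cite: Flicker1998UnitaryFL, §2 Prop. 3 p. 78] -/
theorem exists_frame_of_congr_flickerTorusEltOne {e x₁ x₂ x₃ : LocalRing L v} (h2e : 2 * e = 1)
    (Tl : GL (Fin 3) (LocalRing L v))
    (ψ : ↥(UnitaryGroup.«local» L (IsCMField.complexConj L) 3 H' v) ≃ₜ*
        ↥(UnitaryGroup.«local» L (IsCMField.complexConj L) 3 (Matrix.of fun i j : Fin 3 => if i.val + j.val + 1 = 3 then (1 : L) else 0) v))
    (t : (cmDatum L 3 H').Local v) (hψ : ∀ g, (ψ g).val = Tl * g.val * Tl⁻¹)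
    (hlit : (ψ t).val.val = !![e * (x₁ + x₃), 0, -(e * (x₁ - x₃)); 0, x₂, 0; -(e * (x₁ - x₃)), 0, e * (x₁ + x₃)]) :
    ∃ Q : GL (Fin 3) (LocalRing L v), (t.val.val : Matrix (Fin 3) (Fin 3) (LocalRing L v)) * Q.val = Q.val * diagonal ![x₁, x₂, x₃] := by
  set P₁ : GL (Fin 3) (LocalRing L v) := ⟨_, _, Flicker1998.flickerFrame_mul_inv h2e, Flicker1998.flickerFrameInv_mul h2e⟩ with hP₁def
  have htval : (t.val.val : Matrix (Fin 3) (Fin 3) (LocalRing L v)) = Tl⁻¹.val * (ψ t).val.val * Tl.val := by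
    rw [hψ t, Units.val_mul, Units.val_mul, ← Matrix.mul_assoc, ← Matrix.mul_assoc, ← Units.val_mul, inv_mul_cancel, Units.val_one, Matrix.one_mul,
      Matrix.mul_assoc, ← Units.val_mul, inv_mul_cancel, Units.val_one, Matrix.mul_one]
  refine ⟨Tl⁻¹ * P₁, ?_⟩
  have hlit' : (ψ t).val.val = P₁.val * diagonal ![x₁, x₂, x₃] * (P₁⁻¹).val := by
    rw [hlit, Flicker1998.literal_one_eq_conj_diagonal e x₁ x₂ x₃, ← Flicker1998.diagonal_fin_three x₁ x₂ x₃]; rfl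
  rw [htval, Units.val_mul, hlit', Matrix.mul_assoc, Matrix.mul_assoc, Matrix.mul_assoc, ← Matrix.mul_assoc Tl.val, ← Units.val_mul, mul_inv_cancel,
    Units.val_one, Matrix.one_mul, ← Units.val_mul P₁⁻¹, inv_mul_cancel, Units.val_one, Matrix.mul_one, ← Matrix.mul_assoc]

/-- **`χ_{t,w} = (X − x_{1,w})(X − x_{2,w})(X − x_{3,w})`** for `t` congruent to `t_1(x₁,x₂,x₃)` (conjugation does not change `charpoly`; `charpoly` of a diagonal).
[cite: Flicker1998UnitaryFL, §2 Prop. 3 p. 78] -/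
theorem charpoly_map_eq_of_congr_flickerTorusEltOne (w : PlacesOver L v) {e x₁ x₂ x₃ : LocalRing L v} (h2e : 2 * e = 1)
    (Tl : GL (Fin 3) (LocalRing L v))
    (ψ : ↥(UnitaryGroup.«local» L (IsCMField.complexConj L) 3 H' v) ≃ₜ*
        ↥(UnitaryGroup.«local» L (IsCMField.complexConj L) 3 (Matrix.of fun i j : Fin 3 => if i.val + j.val + 1 = 3 then (1 : L) else 0) v))
    (t : (cmDatum L 3 H').Local v) (hψ : ∀ g, (ψ g).val = Tl * g.val * Tl⁻¹)
    (hlit : (ψ t).val.val = !![e * (x₁ + x₃), 0, -(e * (x₁ - x₃)); 0, x₂, 0; -(e * (x₁ - x₃)), 0, e * (x₁ + x₃)]) :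
    (((t.val : GL (Fin 3) (LocalRing L v)).val.map (Pi.evalRingHom (fun w' : PlacesOver L v => w'.1.adicCompletion L) w))).charpoly =
      (X - C (x₁ w)) * (X - C (x₂ w)) * (X - C (x₃ w)) := by
  obtain ⟨Q, hQ⟩ := exists_frame_of_congr_flickerTorusEltOne L H' h2e Tl ψ t hψ hlit
  have ht : (t.val.val : Matrix (Fin 3) (Fin 3) (LocalRing L v)) = Q.val * diagonal ![x₁, x₂, x₃] * Q.val⁻¹ := by
    rw [← hQ, Matrix.mul_assoc, Matrix.mul_nonsing_inv _ (Matrix.isUnits_det_units Q), Matrix.mul_one]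
  rw [Matrix.charpoly_map, ht, Matrix.charpoly_units_conj, Matrix.charpoly_diagonal, Polynomial.map_prod, Fin.prod_univ_three]
  simp only [Polynomial.map_sub, Polynomial.map_X, Polynomial.map_C, Matrix.cons_val_zero, Matrix.cons_val_one, Matrix.cons_val]
  rfl

/-- **DEEPNESS**: if the eigenvalues of the literal are ≡ 1 (`|x_{i,w} − 1|_w < 1`), then `χ_{t,w} ≡ (X − 1)³ (mod 𝔪_w)` coefficientwise — the `ht` input of ★
`classOrbitalIntegral_eq_mul_strata_three_of_deep`. [cite: Kottwitz1986, §3] [cite: Rogawski1990, §4.9 p. 54] -/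
theorem deep_of_congr_flickerTorusEltOne (w : PlacesOver L v) {e x₁ x₂ x₃ : LocalRing L v} (h2e : 2 * e = 1)
    (Tl : GL (Fin 3) (LocalRing L v))
    (ψ : ↥(UnitaryGroup.«local» L (IsCMField.complexConj L) 3 H' v) ≃ₜ*
        ↥(UnitaryGroup.«local» L (IsCMField.complexConj L) 3 (Matrix.of fun i j : Fin 3 => if i.val + j.val + 1 = 3 then (1 : L) else 0) v))
    (t : (cmDatum L 3 H').Local v) (hψ : ∀ g, (ψ g).val = Tl * g.val * Tl⁻¹)
    (hlit : (ψ t).val.val = !![e * (x₁ + x₃), 0, -(e * (x₁ - x₃)); 0, x₂, 0; -(e * (x₁ - x₃)), 0, e * (x₁ + x₃)])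
    (hd₁ : Valued.v (x₁ w - 1) < 1) (hd₂ : Valued.v (x₂ w - 1) < 1) (hd₃ : Valued.v (x₃ w - 1) < 1) :
    ∀ m : ℕ, ValuativeRel.valuation (w.1.adicCompletion L)
      (((((t.val : GL (Fin 3) (LocalRing L v)).val.map (Pi.evalRingHom (fun w' : PlacesOver L v => w'.1.adicCompletion L) w))).charpoly -
        (Polynomial.X - 1) ^ 3).coeff m) < 1 := by
  have hiso := ValuativeRel.isEquiv (ValuativeRel.valuation (w.1.adicCompletion L))
    (Valued.v : Valuation (w.1.adicCompletion L) (WithZero (Multiplicative ℤ)))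
  intro m
  rw [charpoly_map_eq_of_congr_flickerTorusEltOne L H' w h2e Tl ψ t hψ hlit]
  exact valuation_coeff_prod_sub_pow_lt_one _ (hiso.lt_one_iff_lt_one.2 hd₁) (hiso.lt_one_iff_lt_one.2 hd₂) (hiso.lt_one_iff_lt_one.2 hd₃) m

/-- **REGULARITY**: `t` congruent to `t_1(x₁,x₂,x₃)` with `x_i` pairwise distinct is a regular element (★ `isRegularElt_of_eigenframe`).
[cite: Flicker1998UnitaryFL, §2 Prop. 3 p. 78] [cite: Rogawski1990, §4.9 p. 54] -/
theorem isRegularElt_of_congr_flickerTorusEltOne (w : PlacesOver L v) (hw : IsCMField.complexConj L • w.1 = w.1)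
    {e x₁ x₂ x₃ : LocalRing L v} (h2e : 2 * e = 1) (h₁₂ : x₁ ≠ x₂) (h₂₃ : x₂ ≠ x₃) (h₁₃ : x₁ ≠ x₃)
    (Tl : GL (Fin 3) (LocalRing L v))
    (ψ : ↥(UnitaryGroup.«local» L (IsCMField.complexConj L) 3 H' v) ≃ₜ*
        ↥(UnitaryGroup.«local» L (IsCMField.complexConj L) 3 (Matrix.of fun i j : Fin 3 => if i.val + j.val + 1 = 3 then (1 : L) else 0) v))
    (t : (cmDatum L 3 H').Local v) (hψ : ∀ g, (ψ g).val = Tl * g.val * Tl⁻¹)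
    (hlit : (ψ t).val.val = !![e * (x₁ + x₃), 0, -(e * (x₁ - x₃)); 0, x₂, 0; -(e * (x₁ - x₃)), 0, e * (x₁ + x₃)]) :
    IsRegularElt (t.val : GL (Fin 3) (LocalRing L v)) := by
  obtain ⟨Q, hQ⟩ := exists_frame_of_congr_flickerTorusEltOne L H' h2e Tl ψ t hψ hlit
  have hu : Function.Injective ![x₁, x₂, x₃] := by
    intro i j hij
    fin_cases i <;> fin_cases j
    all_goals first | rfl | (exfalso; revert hij; simp [h₁₂, h₂₃, h₁₃, h₁₂.symm, h₂₃.symm, h₁₃.symm])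
  exact isRegularElt_of_eigenframe L H' w hw t hQ hu

/-- **COMPACT CENTRALISER**: `t` congruent to `t_1(x₁,x₂,x₃)` with `x_i` pairwise distinct of norm one has compact centraliser in `G′_v`
(★ `compactSpace_centralizer_of_eigenframe_of_smul_eq`). [cite: Flicker1998UnitaryFL, §2 Prop. 3 p. 78] [cite: Rogawski1990, §4.9 p. 54] -/
theorem compactSpace_centralizer_of_congr_flickerTorusEltOne (hH' : (H'.map (IsCMField.complexConj L))ᵀ = H') (hH'u : IsUnit H')
    (w : PlacesOver L v) (hw : IsCMField.complexConj L • w.1 = w.1)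
    {e x₁ x₂ x₃ : LocalRing L v} (h2e : 2 * e = 1)
    (hx₁ : conjLocal L (IsCMField.complexConj L) v x₁ * x₁ = 1) (hx₂ : conjLocal L (IsCMField.complexConj L) v x₂ * x₂ = 1)
    (hx₃ : conjLocal L (IsCMField.complexConj L) v x₃ * x₃ = 1) (h₁₂ : x₁ ≠ x₂) (h₂₃ : x₂ ≠ x₃) (h₁₃ : x₁ ≠ x₃)
    (Tl : GL (Fin 3) (LocalRing L v))
    (ψ : ↥(UnitaryGroup.«local» L (IsCMField.complexConj L) 3 H' v) ≃ₜ*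
        ↥(UnitaryGroup.«local» L (IsCMField.complexConj L) 3 (Matrix.of fun i j : Fin 3 => if i.val + j.val + 1 = 3 then (1 : L) else 0) v))
    (t : (cmDatum L 3 H').Local v) (hψ : ∀ g, (ψ g).val = Tl * g.val * Tl⁻¹)
    (hlit : (ψ t).val.val = !![e * (x₁ + x₃), 0, -(e * (x₁ - x₃)); 0, x₂, 0; -(e * (x₁ - x₃)), 0, e * (x₁ + x₃)]) :
    CompactSpace (Subgroup.centralizer ({t} : Set ((cmDatum L 3 H').Local v))) := by
  obtain ⟨Q, hQ⟩ := exists_frame_of_congr_flickerTorusEltOne L H' h2e Tl ψ t hψ hlit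
  have hu : Function.Injective ![x₁, x₂, x₃] := by
    intro i j hij
    fin_cases i <;> fin_cases j
    all_goals first | rfl | (exfalso; revert hij; simp [h₁₂, h₂₃, h₁₃, h₁₂.symm, h₂₃.symm, h₁₃.symm])
  have hu1 : ∀ i, conjLocal L (IsCMField.complexConj L) v (![x₁, x₂, x₃] i) * ![x₁, x₂, x₃] i = 1 := by
    intro i; fin_cases i
    · exact hx₁
    · exact hx₂
    · exact hx₃
  have hH'c : (H'.map (cmConjRingHom L))ᵀ = H' := by
    have e1 : H'.map (cmConjRingHom L) = H'.map (IsCMField.complexConj L) := by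
      ext i j; simp [Matrix.map_apply, cmConjRingHom_apply]
    rw [e1]; exact hH'
  have hdet : H'.det ≠ 0 := (Matrix.isUnit_iff_isUnit_det _ |>.1 hH'u).ne_zero
  exact compactSpace_centralizer_of_eigenframe_of_smul_eq L w hw H' hH'c hdet t hQ hu hu1


set_option synthInstance.maxHeartbeats 200000 in  -- the coset action `U_w ↷ U_w ⧸ unitaryInt` (as in ★ `FixedCosetsTransport`)
open scoped Classical in
/-- **THE UNIT ROW AT A θ̄ = 0 LITERAL (measure-free)**: for `t ∈ G′_v` congruent to `t_1(x₁,x₂,x₃)` with `x_i` pairwise distinct of norm one and ≡ 1 (mod 𝔪_w),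
`P = ord_w(x₁ − x₃)`, `Q₁ = ord_w(x₁ − x₂)`: the three residually-unipotent Jordan strata of `Fix_t(G′_v ⧸ K_v)` exhaust it and
`n₀(t) + n₁(t) + n₂(t) = #Fix_t = φ₀(Q₁, Q₂, P)` (★ `sum_range_ncard_strata_eq_ncard_fixedBy` ∘ ★ `natCard_fixedBy_cmLocalIntegralLevel_eq_of_congr` ∘ ★
`natCard_fixedPoints_unitaryInt_corner_eq_phiZero_adicCompletion`). [cite: Flicker1998UnitaryFL, Prop. 14 p. 94; §6 p. 95] [cite: Rogawski1990, §4.9 Prop. 4.9.1 (b) p. 55]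
[cite: Kottwitz1986, §3] -/
theorem sum_ncard_rankStrata_eq_phiZero_of_congr
    (hH' : (H'.map (IsCMField.complexConj L))ᵀ = H') (hH'u : IsUnit H') (w : PlacesOver L v)
    (hw : IsCMField.complexConj L • w.1 = w.1) (hv : Algebra.IsUnramifiedIn (𝓞 L) v.asIdeal)
    (h2 : IsUnit (2 : 𝒪[w.1.adicCompletion L]))
    {e y x₁ x₂ x₃ : LocalRing L v} (h2e : 2 * e = 1)
    (hy : conjLocal L (IsCMField.complexConj L) v y * y = -2)
    (hx₁ : conjLocal L (IsCMField.complexConj L) v x₁ * x₁ = 1) (hx₂ : conjLocal L (IsCMField.complexConj L) v x₂ * x₂ = 1)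
    (hx₃ : conjLocal L (IsCMField.complexConj L) v x₃ * x₃ = 1) (h₁₂ : x₁ ≠ x₂) (h₂₃ : x₂ ≠ x₃) (h₁₃ : x₁ ≠ x₃)
    (Tl : GL (Fin 3) (LocalRing L v))
    (ψ : ↥(UnitaryGroup.«local» L (IsCMField.complexConj L) 3 H' v) ≃ₜ*
        ↥(UnitaryGroup.«local» L (IsCMField.complexConj L) 3 (Matrix.of fun i j : Fin 3 => if i.val + j.val + 1 = 3 then (1 : L) else 0) v))
    (t : (cmDatum L 3 H').Local v)
    (hψ : ∀ g, (ψ g).val = Tl * g.val * Tl⁻¹)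
    (hlev : ∀ g, g ∈ cmLocalIntegralLevel L 3 H' v ↔
        ψ g ∈ cmLocalIntegralLevel L 3 (Matrix.of fun i j : Fin 3 => if i.val + j.val + 1 = 3 then (1 : L) else 0) v)
    (hlit : (ψ t).val.val =
          !![e * (x₁ + x₃), 0, -(e * (x₁ - x₃)); 0, x₂, 0; -(e * (x₁ - x₃)), 0, e * (x₁ + x₃)])
    {P Q₁ Q₂ : ℕ} (hP : Valued.v (x₁ w - x₃ w) = WithZero.exp (-(P : ℤ))) (hQ₁ : Valued.v (x₁ w - x₂ w) = WithZero.exp (-(Q₁ : ℤ)))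
    (hQ₂ : Valued.v (x₃ w - x₂ w) = WithZero.exp (-(Q₂ : ℤ)))
    (htri : (Q₁ = Q₂ ∧ Q₁ ≤ P) ∨ (Q₁ = P ∧ Q₁ ≤ Q₂) ∨ (Q₂ = P ∧ Q₂ ≤ Q₁))
    (hd₁ : Valued.v (x₁ w - 1) < 1) (hd₂ : Valued.v (x₂ w - 1) < 1) (hd₃ : Valued.v (x₃ w - 1) < 1) :
    ((∑ r ∈ Finset.range 3, {q : (cmDatum L 3 H').Local v ⧸ cmLocalIntegralLevel L 3 H' v |
        q ∈ MulAction.fixedBy ((cmDatum L 3 H').Local v ⧸ cmLocalIntegralLevel L 3 H' v) t ∧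
          (redMat ((((q.out⁻¹ * t * q.out : (cmDatum L 3 H').Local v)).val : GL (Fin 3) (LocalRing L v)).val.map
            (Pi.evalRingHom (fun w' : PlacesOver L v => w'.1.adicCompletion L) w)) - 1).rank = r}.ncard : ℕ) : ℚ) =
      Flicker1998.phiZero (Ideal.absNorm v.asIdeal) Q₁ Q₂ P := by
  have hc1 : IsCMField.complexConj L ≠ 1 := IsCMField.complexConj_ne_one L
  -- `𝒪_w` is `𝔪`-adically complete (★ p842102)
  haveI : IsAdicComplete (IsLocalRing.maximalIdeal (Valued.integer (w.1.adicCompletion L))) (Valued.integer (w.1.adicCompletion L)) :=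
    isAdicComplete_maximalIdeal_valuedInteger_adicCompletion L w.1
  haveI : Algebra.IsQuadraticExtension ↥(maximalRealSubfield L) L := IsCMField.isQuadraticExtension L
  -- (1) regularity, compact centraliser, deepness
  have hH'c : (H'.map (cmConjRingHom L))ᵀ = H' := by
    have e1 : H'.map (cmConjRingHom L) = H'.map (IsCMField.complexConj L) := by
      ext i j; simp [Matrix.map_apply, cmConjRingHom_apply]
    rw [e1]; exact hH'
  have hdet : H'.det ≠ 0 := (Matrix.isUnit_iff_isUnit_det _ |>.1 hH'u).ne_zero
  have hreg : IsRegularElt (t.val : GL (Fin 3) (LocalRing L v)) := isRegularElt_of_congr_flickerTorusEltOne L H' w hw h2e h₁₂ h₂₃ h₁₃ Tl ψ t hψ hlit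
  haveI : CompactSpace (Subgroup.centralizer ({t} : Set ((cmDatum L 3 H').Local v))) :=
    compactSpace_centralizer_of_congr_flickerTorusEltOne L H' hH' hH'u w hw h2e hx₁ hx₂ hx₃ h₁₂ h₂₃ h₁₃ Tl ψ t hψ hlit
  have ht := deep_of_congr_flickerTorusEltOne L H' w h2e Tl ψ t hψ hlit hd₁ hd₂ hd₃
  -- (2) the strata exhaust the fixed cosets (★ O8b)
  have hpart : ∑ r ∈ Finset.range 3, {q : (cmDatum L 3 H').Local v ⧸ cmLocalIntegralLevel L 3 H' v |
        q ∈ MulAction.fixedBy ((cmDatum L 3 H').Local v ⧸ cmLocalIntegralLevel L 3 H' v) t ∧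
          (redMat ((((q.out⁻¹ * t * q.out : (cmDatum L 3 H').Local v)).val : GL (Fin 3) (LocalRing L v)).val.map
            (Pi.evalRingHom (fun w' : PlacesOver L v => w'.1.adicCompletion L) w)) - 1).rank = r}.ncard =
      (MulAction.fixedBy ((cmDatum L 3 H').Local v ⧸ cmLocalIntegralLevel L 3 H' v) t).ncard :=
    sum_range_ncard_strata_eq_ncard_fixedBy t (cmLocalIntegralLevel L 3 H' v)
      (isCompact_isOpen_cmLocalIntegralLevel L 3 H' v).2 (isCompact_isOpen_cmLocalIntegralLevel L 3 H' v).1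
      (isClosed_conjClass_local_of_isRegularElt L 3 H' v hH'c hdet t hreg)
      {k | (redMat (((k.val : GL (Fin 3) (LocalRing L v)).val.map (Pi.evalRingHom (fun w' : PlacesOver L v => w'.1.adicCompletion L) w))) - 1) ^ 3 = 0}
      (fun k => (redMat (((k.val : GL (Fin 3) (LocalRing L v)).val.map (Pi.evalRingHom (fun w' : PlacesOver L v => w'.1.adicCompletion L) w))) - 1).rank) 3
      (fun k _ hkU => rank_lt_of_isNilpotent ⟨3, hkU⟩ (by norm_num)) (fun x hx => redMat_sub_one_pow_eq_zero_of_deep L 3 H' v w hw t ht x hx)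
  rw [hpart, ← Nat.card_coe_set_eq, natCard_fixedBy_cmLocalIntegralLevel_eq_of_congr L H' w hw ψ hlev t]
  -- (3) the data at `w`
  have h2L : (2 : 𝓞 L) ∉ w.1.asIdeal := by
    have h2w : Valued.v (2 : w.1.adicCompletion L) = 1 := (isUnit_two_integer_iff_valued_eq_one L w.1).1 h2
    have e1 : (algebraMap L (w.1.adicCompletion L)) (algebraMap (𝓞 L) L 2) = 2 := by rw [map_ofNat, map_ofNat]
    rw [← e1] at h2w
    change Valued.v ((algebraMap (𝓞 L) L 2 : L) : w.1.adicCompletion L) = 1 at h2w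
    rw [HeightOneSpectrum.valuedAdicCompletion_eq_valuation', HeightOneSpectrum.valuation_of_algebraMap] at h2w
    exact HeightOneSpectrum.intValuation_eq_one_iff.1 h2w
  have h2F : (2 : 𝓞 ↥(maximalRealSubfield L)) ∉ v.asIdeal := by
    intro hmem
    apply h2L
    have h := congrArg HeightOneSpectrum.asIdeal w.2
    rw [← h] at hmem
    simp only [HeightOneSpectrum.under_asIdeal, Ideal.under_def, Ideal.mem_comap, map_ofNat] at hmem
    exact hmem
  have hσw : ∀ z : LocalRing L v, conjLocal L (IsCMField.complexConj L) v z w = galAdicCompletionMap (L := L) (IsCMField.complexConj L) hw (z w) :=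
    fun z => conjLocal_apply_eq_of_smul_eq (IsCMField.complexConj L) hc1 v w hw z
  have hyw : y w * galAdicCompletionMap (L := L) (IsCMField.complexConj L) hw (y w) = -2 := by
    rw [← hσw, mul_comm]; exact (congrFun hy w : _)
  have hx₁w : galAdicCompletionMap (L := L) (IsCMField.complexConj L) hw (x₁ w) * x₁ w = 1 := by
    rw [← hσw]; exact (congrFun hx₁ w : _)
  have hx₂w : galAdicCompletionMap (L := L) (IsCMField.complexConj L) hw (x₂ w) * x₂ w = 1 := by
    rw [← hσw]; exact (congrFun hx₂ w : _)
  have hx₃w : galAdicCompletionMap (L := L) (IsCMField.complexConj L) hw (x₃ w) * x₃ w = 1 := by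
    rw [← hσw]; exact (congrFun hx₃ w : _)
  have h2ew : 2 * e w = 1 := by
    have := congrFun h2e w; simpa using this
  -- the literal read at `w`
  have hte : (((localNonsplitEquiv (IsCMField.complexConj L) (Matrix.of fun i j : Fin 3 => if i.val + j.val + 1 = 3 then (1 : L) else 0) hc1 w hw (ψ t) :
        unitaryGroupOfForm (galAdicCompletionMap (L := L) (IsCMField.complexConj L) hw)
          (placeForm (Matrix.of fun i j : Fin 3 => if i.val + j.val + 1 = 3 then (1 : L) else 0) w.1)) :
        GL (Fin 3) (w.1.adicCompletion L)) : Matrix (Fin 3) (Fin 3) (w.1.adicCompletion L)) =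
      !![e w * (x₁ w + x₃ w), 0, -(e w * (x₁ w - x₃ w)); 0, x₂ w, 0; -(e w * (x₁ w - x₃ w)), 0, e w * (x₁ w + x₃ w)] := by
    rw [coe_coe_localNonsplitEquiv_apply, hlit]
    ext i j
    fin_cases i <;> fin_cases j <;> rfl
  -- finiteness of the fixed cosets (elliptic regular `t`)
  have hfinG : (MulAction.fixedBy ((cmDatum L 3 H').Local v ⧸ cmLocalIntegralLevel L 3 H' v) t).Finite :=
    finite_fixedBy_quotient_of_isClosed t (cmLocalIntegralLevel L 3 H' v) (isClosed_conjClass_local_of_isRegularElt L 3 H' v hH'c hdet t hreg)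
      (isCompact_isOpen_cmLocalIntegralLevel L 3 H' v).2 (isCompact_isOpen_cmLocalIntegralLevel L 3 H' v).1
  have hfin := (finite_fixedBy_cmLocalIntegralLevel_iff_of_congr L H' w hw ψ hlev t).1 hfinG
  -- (4) the θ̄ = 0 count at `L_w` (★ X₁)
  exact natCard_fixedPoints_unitaryInt_corner_eq_phiZero_adicCompletion L w hw hv h2F hyw h2ew hx₁w hx₂w hx₃w hte hP hQ₁ hQ₂ htri hfin

/-- **THE VALUE OF A DEPTH-ZERO PIECE AT A θ̄ = 0 LITERAL**: ★ O8b `classOrbitalIntegral_eq_mul_strata_three_of_deep` with its three inputs (`hreg`, compact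
centraliser, `ht`) discharged for `t` congruent to `t_1(x₁,x₂,x₃)` near `1`: `Φ(⟦t⟧, g) = ν_G(K_v) · (c₀ n₀(t) + c₁ n₁(t) + c₂ n₂(t))` — the `hΦ₁` of the
socket ★ `finsum_finExplicitDelta_mul_classOrbitalIntegral_eq_of_split_of_strata`. [cite: Rogawski1990, §4.9 p. 54, Prop. 4.9.1 (b) p. 55] [cite: Kottwitz1986, §3]
[cite: Flicker1998UnitaryFL, §2 Prop. 3 p. 78] -/
theorem classOrbitalIntegral_eq_mul_strata_of_congr_flickerTorusEltOne
    (hH' : (H'.map (IsCMField.complexConj L))ᵀ = H') (hH'u : IsUnit H') (w : PlacesOver L v)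
    (hw : IsCMField.complexConj L • w.1 = w.1)
    [MeasurableSpace ((cmDatum L 3 H').Local v)] [BorelSpace ((cmDatum L 3 H').Local v)]
    [∀ γ : ((cmDatum L 3 H').Local v), MeasurableSpace (((cmDatum L 3 H').Local v) ⧸ Subgroup.centralizer ({γ} : Set ((cmDatum L 3 H').Local v)))]
    [∀ γ : ((cmDatum L 3 H').Local v), BorelSpace (((cmDatum L 3 H').Local v) ⧸ Subgroup.centralizer ({γ} : Set ((cmDatum L 3 H').Local v)))]
    (νG : Measure ((cmDatum L 3 H').Local v)) [νG.IsHaarMeasure] [νG.IsMulRightInvariant]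
    {mG : OrbitalMeasureFamily ((cmDatum L 3 H').Local v)}
    (hmG : mG.IsCanonical (fun γ => IsRegularElt (γ.val : GL (Fin 3) (UnitaryGroup.LocalRing L v))) νG)
    -- the depth-zero piece
    (g : ((cmDatum L 3 H').Local v) → ℂ) (hg : IsLocSmooth g) (hgK : tsupport g ⊆ (cmLocalIntegralLevel L 3 H' v : Set ((cmDatum L 3 H').Local v)))
    (hginv : ∀ u ∈ cmLocalIntegralLevel L 3 H' v, ∀ x, g (u * x * u⁻¹) = g x)
    (c : ℕ → ℂ)
    (hc : ∀ k ∈ cmLocalIntegralLevel L 3 H' v,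
      (redMat (((k.val : GL (Fin 3) (UnitaryGroup.LocalRing L v)).val.map (Pi.evalRingHom (fun w' : PlacesOver L v => w'.1.adicCompletion L) w))) - 1) ^ 3 = 0 →
      g k = c (redMat (((k.val : GL (Fin 3) (UnitaryGroup.LocalRing L v)).val.map (Pi.evalRingHom (fun w' : PlacesOver L v => w'.1.adicCompletion L) w))) - 1).rank)
    -- the literal
    {e x₁ x₂ x₃ : LocalRing L v} (h2e : 2 * e = 1)
    (hx₁ : conjLocal L (IsCMField.complexConj L) v x₁ * x₁ = 1) (hx₂ : conjLocal L (IsCMField.complexConj L) v x₂ * x₂ = 1)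
    (hx₃ : conjLocal L (IsCMField.complexConj L) v x₃ * x₃ = 1) (h₁₂ : x₁ ≠ x₂) (h₂₃ : x₂ ≠ x₃) (h₁₃ : x₁ ≠ x₃)
    (Tl : GL (Fin 3) (LocalRing L v))
    (ψ : ↥(UnitaryGroup.«local» L (IsCMField.complexConj L) 3 H' v) ≃ₜ*
        ↥(UnitaryGroup.«local» L (IsCMField.complexConj L) 3 (Matrix.of fun i j : Fin 3 => if i.val + j.val + 1 = 3 then (1 : L) else 0) v))
    (t : (cmDatum L 3 H').Local v)
    (hψ : ∀ g, (ψ g).val = Tl * g.val * Tl⁻¹)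
    (hlit : (ψ t).val.val =
          !![e * (x₁ + x₃), 0, -(e * (x₁ - x₃)); 0, x₂, 0; -(e * (x₁ - x₃)), 0, e * (x₁ + x₃)])
    (hd₁ : Valued.v (x₁ w - 1) < 1) (hd₂ : Valued.v (x₂ w - 1) < 1) (hd₃ : Valued.v (x₃ w - 1) < 1) :
    classOrbitalIntegral mG g (ConjClasses.mk t) =
      (νG.real (cmLocalIntegralLevel L 3 H' v : Set ((cmDatum L 3 H').Local v)) : ℂ) *
        (c 0 * ({q : (cmDatum L 3 H').Local v ⧸ cmLocalIntegralLevel L 3 H' v |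
            q ∈ MulAction.fixedBy ((cmDatum L 3 H').Local v ⧸ cmLocalIntegralLevel L 3 H' v) t ∧
              (redMat ((((q.out⁻¹ * t * q.out : (cmDatum L 3 H').Local v)).val : GL (Fin 3) (LocalRing L v)).val.map
                (Pi.evalRingHom (fun w' : PlacesOver L v => w'.1.adicCompletion L) w)) - 1).rank = 0}.ncard : ℂ) +
          c 1 * ({q : (cmDatum L 3 H').Local v ⧸ cmLocalIntegralLevel L 3 H' v |
            q ∈ MulAction.fixedBy ((cmDatum L 3 H').Local v ⧸ cmLocalIntegralLevel L 3 H' v) t ∧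
              (redMat ((((q.out⁻¹ * t * q.out : (cmDatum L 3 H').Local v)).val : GL (Fin 3) (LocalRing L v)).val.map
                (Pi.evalRingHom (fun w' : PlacesOver L v => w'.1.adicCompletion L) w)) - 1).rank = 1}.ncard : ℂ) +
          c 2 * ({q : (cmDatum L 3 H').Local v ⧸ cmLocalIntegralLevel L 3 H' v |
            q ∈ MulAction.fixedBy ((cmDatum L 3 H').Local v ⧸ cmLocalIntegralLevel L 3 H' v) t ∧
              (redMat ((((q.out⁻¹ * t * q.out : (cmDatum L 3 H').Local v)).val : GL (Fin 3) (LocalRing L v)).val.map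
                (Pi.evalRingHom (fun w' : PlacesOver L v => w'.1.adicCompletion L) w)) - 1).rank = 2}.ncard : ℂ)) := by
  have hH'c : (H'.map (cmConjRingHom L))ᵀ = H' := by
    have e1 : H'.map (cmConjRingHom L) = H'.map (IsCMField.complexConj L) := by
      ext i j; simp [Matrix.map_apply, cmConjRingHom_apply]
    rw [e1]; exact hH'
  have hdet : H'.det ≠ 0 := (Matrix.isUnit_iff_isUnit_det _ |>.1 hH'u).ne_zero
  have hreg : IsRegularElt (t.val : GL (Fin 3) (LocalRing L v)) := isRegularElt_of_congr_flickerTorusEltOne L H' w hw h2e h₁₂ h₂₃ h₁₃ Tl ψ t hψ hlit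
  haveI : CompactSpace (Subgroup.centralizer ({t} : Set ((cmDatum L 3 H').Local v))) :=
    compactSpace_centralizer_of_congr_flickerTorusEltOne L H' hH' hH'u w hw h2e hx₁ hx₂ hx₃ h₁₂ h₂₃ h₁₃ Tl ψ t hψ hlit
  have ht := deep_of_congr_flickerTorusEltOne L H' w h2e Tl ψ t hψ hlit hd₁ hd₂ hd₃
  exact classOrbitalIntegral_eq_mul_strata_three_of_deep L v w hw νG hH'c hdet hmG t hreg ht g hg hgK hginv c hc

end ThetaZero

end Literature.NumberTheory.Rogawski1990

end
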